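import Summits.ResolutionOfSingularities.ResolutionOfSingularities.Theses.PAlteration
import Summits.ResolutionOfSingularities.ResolutionOfSingularities.Theses.FoliationDescent
import Summits.ResolutionOfSingularities.ResolutionOfSingularities.Theorems.PAlterationPialtSqueezeRRLU1
import Summits.ResolutionOfSingularities.ResolutionOfSingularities.Theorems.PAlterationPalterationThesisPerfectTransfer
import Summits.ResolutionOfSingularities.ResolutionOfSingularities.Theorems.PAlterationPialtKnownCases
import Literature.AlgebraicGeometry.Resolution.LocalUniformization
import HarnessLib

/-!
# Skeleton `foliation-sandwich` — an ALTERNATIVE line for crux stmt-ResolutionOfSingularities-0555 `Pialt`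
# (crux strategist s1, 2026-08-17; registered `--alt`, it does NOT replace the live `Lines/SketchIdeator2.lean`)

`Pialt` (Abramovich–Oort / Temkin 2013 Conj. 1.3.1 in characteristic `p`): every integral
separated scheme of finite type over a field of characteristic `p` has a purely inseparable
REGULAR alteration.

THE LINE. Perfect ground fields suffice (`pialt_of_pialt_perfectField`, landed). Over a perfect
`k`, Temkin's inseparable local uniformization (`stub_inseparableLU`, a published theorem) puts a
REGULAR finitely generated model `B` of a finite purely inseparable `L ⊇ K` inside every valuation
ring; the lead's descent (`isLocallyUniformizable_of_temkin2013_of_rrLU1_at`, p136512, landed)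
peels `L/K` one HEIGHT-ONE step `K ⊆ K(y)`, `y ^ p ∈ K`, at a time, so that classical local
uniformization over `k` reduces to RRLU1: uniformize the valuations of `K` centred BELOW a
height-one Frobenius sandwich `Spec (B ∩ K)` of a regular affine `Spec B`, `Frac B = K(y)`.
By Jacobson, `K = K(y)^D` for the `p`-closed derivation `D = d/dy` (`D^p = 0`), and `B ∩ K` is
the ring of `D`-constants of `B`: RRLU1 is local uniformization of quotients of regular
varieties by ONE `p`-closed rational vector field. THIS is where the line differs from
`SketchIdeator2` (whose atom `stub_rrLU1`/`stub_picover` has no mechanism inside the line): the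
height-one step is handed to route `FoliationDescent`'s two LOCAL cruxes —
`FolLU` (stmt-17081: blow up `D`-invariant regular centres along the valuation until `g • D` is
NON-SINGULAR or MULTIPLICATIVE at the centre — the Rudakov–Shafarevich dichotomy, counter
`(ord D, Jordan type, ord λ)`) and `LogCanQuotLU` (stmt-17082: in that situation the constants
are uniformized — Taylor projection in the non-singular case, the toric `μ_p`-quotient in the
multiplicative case) — through an ELEMENTARY bridge `stub_foliationBridge` (the lead's own
target `rrLU1_perfect_of_folLU_of_logCanQuotLU`, here a registered stub: `D := d/dy` on
`L = K[X]/(X^p − a)`, `ker D = K`, apply `FolLU` to `(L, O, B, D)`, then `LogCanQuotLU` with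
`R := ⊥`, transport the constants into `O ∩ K`). Local uniformization over perfect fields is then
patched into resolutions over perfect fields by `stub_patchingPerfect` (Zariski patching in its
weakest, ABSOLUTE-LU, perfect-field form; it follows field by field from Piltant's two-model
patching `ProperModel.TwoModelPatching p`, the live line's atom, by the tree engine
`resolutionOverUpToDim_of_properPatching_of_lu`), a resolution is a purely inseparable regular
alteration (`pialtConclusion_of_hasResolution`), and `Pialt` descends from the perfect closure.
The line BYPASSES `FoliationDescent`'s heavier items `DualSandwich` (17083), `TorsorLUPerfect`,
`TorsorToLurelPerfect` (16162), the RELATIVE patching `PatchingRelPerfect` (16161) and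
`DescentPerfectToAll` (0549): for `Pialt`, absolute LU and perfect fields are enough.

Registered stubs (5): `stub_inseparableLU` (Temkin 2013 Thm 1.3.2, named fact),
`stub_folLU` (= `FoliationDescent.FolLU`, crux 17081), `stub_logCanQuotLU`
(= `FoliationDescent.LogCanQuotLU`, crux 17082), `stub_foliationBridge` (NEW, M-sized, the
line's own: `FolLU → LogCanQuotLU → RRLU1` over perfect fields), `stub_patchingPerfect`
(absolute-LU Zariski patching over perfect fields, open from dim 4; `⇐ TwoModelPatching`).
Composition `Pialt_of_stubs` / `Pialt_of` is sorry-free and concludes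
`Summit.ResolutionOfSingularities.ResolutionOfSingularities.Theses.PAlteration.Pialt` BY NAME.

Disproof used (`Cruxes/Pialt/Disproof.lean`): `pialt_false_without_isIntegral` /
`_irreducible` — honoured in `Pialt_of_stubs` (`pialtConclusion_of_hasResolution` needs
`[IsIntegral X]`); `pialt_false_without_locallyOfFiniteType` — honoured: `stub_patchingPerfect`
and the squeeze are statements about schemes of finite type / finitely generated `K/k`
(`exists_topologicalKrullDim_le_of_locallyOfFiniteType`); §D (`PialtBirational ↔ summit`) —
acknowledged: over PERFECT fields this line outputs honest resolutions (summit strength there);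
the purely inseparable slack of `Pialt` is spent exactly once, on the ground-field extension
`k ⊆ k^{1/p^∞}` (`pialt_of_pialt_perfectField`); §D′ (finite strengthening false) — not
touched (blow-ups happen inside `FolLU` and patching).
-/

set_option linter.dupNamespace false

noncomputable section

open CategoryTheory AlgebraicGeometry IsLocalRing
open Literature.AlgebraicGeometry.Resolution
open Summit.ResolutionOfSingularities.ResolutionOfSingularities.Theses.PAlteration (Pialt)
open Summit.ResolutionOfSingularities.ResolutionOfSingularities.Theses.FoliationDescent
  (FolLU LogCanQuotLU)
open Summit.ResolutionOfSingularities.ResolutionOfSingularities.Theorems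
  (pialt_of_pialt_perfectField pialtConclusion_of_hasResolution)
open Summit.ResolutionOfSingularities.ResolutionOfSingularities.Theorems.Pialt.RadiciallyRegular
  (isLocallyUniformizable_of_temkin2013_of_rrLU1_at)

namespace Summit.ResolutionOfSingularities.ResolutionOfSingularities.Cruxes.Pialt.FoliationSandwich

/-! ## Stubs -/

/-- STUB 1 (named fact, published; genuinely large to formalize): **Temkin's inseparable local
uniformization** (Temkin 2013, Thm. 1.3.2, weak form `Literature…Temkin2013`): every valuation
ring `O ⊇ k` of a finitely generated `K/k` is uniformized on a finite purely inseparable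
extension of `K`. In-tree discharge programme: `Temkin2013.of_section5_frontier`,
`Temkin2013.of_smoothFibre` (open leaf `Temkin2013RelativeCurveSmoothFibre`). -/
theorem stub_inseparableLU : Temkin2013.{0} := by
  sorry

/-- STUB 2 (= crux `FoliationDescent.FolLU`, stmt-17081, open-problem sized): **foliation local
uniformization** over a perfect field — along a valuation, a nonzero `p`-closed derivation `D`
of `K` becomes, after enlarging the regular-at-the-centre model and rescaling, NON-SINGULAR or
MULTIPLICATIVE at the centre (Rudakov–Shafarevich dichotomy reached by blowing up `D`-invariant
regular centres; counter `(ord D, Jordan type, ord λ)`). -/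
theorem stub_folLU : FolLU := by
  sorry

/-- STUB 3 (= crux `FoliationDescent.LogCanQuotLU`, stmt-17082, L-sized): **log-canonical quotients
uniformize** — in the output situation of `FolLU`, the `D`-constants inside the valuation ring
contain a finitely generated model of `K^D`, regular at the centre (Taylor projection in the
non-singular case; the toric `μ_p`-quotient `k'[[x]]^(Σ λᵢ xᵢ ∂ᵢ)` in the multiplicative case). -/
theorem stub_logCanQuotLU : LogCanQuotLU := by
  sorry

/-- STUB 4 (NEW, the line's own, M-sized; verbatim the lead's bridge target
`rrLU1_perfect_of_folLU_of_logCanQuotLU` of `Lines/SketchIdeator2_bridge_FoliationDescent.lean`):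
**`FolLU → LogCanQuotLU → RRLU1` over PERFECT ground fields.** For `L = K(y)`, `y ^ p = a ∈ K`,
`y ∉ K`: `D := d/dy` is a `K`-derivation of `L ≅ K[X]/(X^p − a)` with `D ≠ 0`, `D^[p] = 0 = 0 • D`
and `ker D = K`; apply `FolLU` to `(k, L, O, S := B, D)` (`B` regular, hence regular at the
centre), then `LogCanQuotLU` with `R := ⊥`; the returned finitely generated algebra `A` of
`D`-constants lies in `O ∩ K`, has `Frac A = ker D = K` and is regular at the centre — i.e.
`IsLocallyUniformizable k K (O ∩ K)`. Degenerate case `y ∈ K`: `B ∩ K = B`. -/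
theorem stub_foliationBridge (hF : FolLU) (hQ : LogCanQuotLU) (p : ℕ) (hp : p.Prime) :
    ∀ (k K L : Type) [Field k] [CharP k p] [PerfectField k] [Field K] [Field L] [Algebra k K]
      [Algebra K L] [Algebra k L] [IsScalarTower k K L], (⊤ : IntermediateField k K).FG →
      IsPurelyInseparable K L →
      (∃ y : L, y ^ p ∈ (algebraMap K L).range ∧ IntermediateField.adjoin K {y} = ⊤) →
      ∀ B : Subalgebra k L, B.FG → IsFractionRing B L → IsRegularRing B →
      ∀ O : ValuationSubring L, B.toSubring ≤ O.toSubring →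
        IsLocallyUniformizable k K (O.comap (algebraMap K L)) := by
  sorry

/-- STUB 5 (crux-sized, open from dimension 4; `⇐ ProperModel.TwoModelPatching p` field by field
via `resolutionOverUpToDim_of_properPatching_of_lu`, `⇐ ResolutionInChar p`): **Zariski patching
over PERFECT ground fields, absolute-LU form** — if every valuation ring `O ⊇ k` of every finitely
generated `K/k` with `k` perfect of characteristic `p` is locally uniformizable, then every
reduced separated scheme of finite type over every perfect field of characteristic `p` has a
resolution. (Perfect-field twin of `Valuative.Patching`, stmt-0561; known in dim ≤ 3:
Zariski 1944, Piltant 2013 Prop. 5.1, Cossart–Piltant 2008 §4.) -/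
theorem stub_patchingPerfect (p : ℕ) (hp : p.Prime) :
    (∀ (k K : Type) [Field k] [CharP k p] [PerfectField k] [Field K] [Algebra k K],
      (⊤ : IntermediateField k K).FG → ∀ O : ValuationSubring K, (∀ c : k, algebraMap k K c ∈ O) →
        ∃ (A : Subalgebra k K) (h : A.toSubring ≤ O.toSubring), A.FG ∧ IsFractionRing A K ∧
          IsRegularLocalRing (Localization.AtPrime
            (Ideal.comap (Subring.inclusion h) (IsLocalRing.maximalIdeal O)))) →
    ∀ (k : Type) [Field k] [CharP k p] [PerfectField k] (X : Scheme.{0})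
      (f : X ⟶ Spec (.of k)), IsSeparated f → LocallyOfFiniteType f → QuasiCompact f →
      IsReduced X → Scheme.HasResolution X := by
  sorry

/-! ## Composition (sorry-free) -/

/-- RRLU1 over a fixed perfect field, from the output of the bridge (stubs 2–4). -/
theorem rrLU1_perfect
    (hB : ∀ (p : ℕ), p.Prime → ∀ (k K L : Type) [Field k] [CharP k p] [PerfectField k] [Field K]
      [Field L] [Algebra k K] [Algebra K L] [Algebra k L] [IsScalarTower k K L],
      (⊤ : IntermediateField k K).FG → IsPurelyInseparable K L →
      (∃ y : L, y ^ p ∈ (algebraMap K L).range ∧ IntermediateField.adjoin K {y} = ⊤) →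
      ∀ B : Subalgebra k L, B.FG → IsFractionRing B L → IsRegularRing B →
      ∀ O : ValuationSubring L, B.toSubring ≤ O.toSubring →
        IsLocallyUniformizable k K (O.comap (algebraMap K L)))
    {p : ℕ} [hp : Fact p.Prime] (k : Type) [Field k] [CharP k p] [PerfectField k] :
    ∀ (K L : Type) [Field K] [Field L] [Algebra k K] [Algebra K L] [Algebra k L]
      [IsScalarTower k K L], (⊤ : IntermediateField k K).FG → IsPurelyInseparable K L →
      (∃ y : L, y ^ p ∈ (algebraMap K L).range ∧ IntermediateField.adjoin K {y} = ⊤) →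
      ∀ B : Subalgebra k L, B.FG → IsFractionRing B L → IsRegularRing B →
      ∀ O : ValuationSubring L, B.toSubring ≤ O.toSubring →
        IsLocallyUniformizable k K (O.comap (algebraMap K L)) :=
  fun K L _ _ _ _ _ _ => hB p hp.out k K L

/-- **Local uniformization over every PERFECT field of characteristic `p`** from stub 1 and the
output of the bridge (Temkin at the top of the tower, the descent peels height-one steps, the
bridge uniformizes each step through `FolLU ∧ LogCanQuotLU`). -/
theorem isLocallyUniformizable_perfect (hT : Temkin2013.{0})
    (hB : ∀ (p : ℕ), p.Prime → ∀ (k K L : Type) [Field k] [CharP k p] [PerfectField k] [Field K]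
      [Field L] [Algebra k K] [Algebra K L] [Algebra k L] [IsScalarTower k K L],
      (⊤ : IntermediateField k K).FG → IsPurelyInseparable K L →
      (∃ y : L, y ^ p ∈ (algebraMap K L).range ∧ IntermediateField.adjoin K {y} = ⊤) →
      ∀ B : Subalgebra k L, B.FG → IsFractionRing B L → IsRegularRing B →
      ∀ O : ValuationSubring L, B.toSubring ≤ O.toSubring →
        IsLocallyUniformizable k K (O.comap (algebraMap K L)))
    {p : ℕ} [Fact p.Prime] (k : Type) [Field k] [CharP k p] [PerfectField k]
    (K : Type) [Field K] [Algebra k K] (hfg : (⊤ : IntermediateField k K).FG)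
    (O : ValuationSubring K) (hO : ∀ c : k, algebraMap k K c ∈ O) :
    IsLocallyUniformizable k K O :=
  isLocallyUniformizable_of_temkin2013_of_rrLU1_at hT k (rrLU1_perfect hB k) K hfg O hO

/-- **COMPOSITION as an implication of the five stub statements** (sorry-free): the crux `Pialt`
BY NAME. Perfect fields suffice; LU over perfect fields from stubs 1–4; resolution over perfect
fields by stub 5; a resolution is a purely inseparable regular alteration. -/
theorem Pialt_of_stubs (hT : Temkin2013.{0}) (hF : FolLU) (hQ : LogCanQuotLU)
    (hB : FolLU → LogCanQuotLU → ∀ (p : ℕ), p.Prime → ∀ (k K L : Type) [Field k] [CharP k p]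
      [PerfectField k] [Field K] [Field L] [Algebra k K] [Algebra K L] [Algebra k L]
      [IsScalarTower k K L],
      (⊤ : IntermediateField k K).FG → IsPurelyInseparable K L →
      (∃ y : L, y ^ p ∈ (algebraMap K L).range ∧ IntermediateField.adjoin K {y} = ⊤) →
      ∀ B : Subalgebra k L, B.FG → IsFractionRing B L → IsRegularRing B →
      ∀ O : ValuationSubring L, B.toSubring ≤ O.toSubring →
        IsLocallyUniformizable k K (O.comap (algebraMap K L)))
    (hP : ∀ (p : ℕ), p.Prime →
      (∀ (k K : Type) [Field k] [CharP k p] [PerfectField k] [Field K] [Algebra k K],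
        (⊤ : IntermediateField k K).FG → ∀ O : ValuationSubring K,
          (∀ c : k, algebraMap k K c ∈ O) →
          ∃ (A : Subalgebra k K) (h : A.toSubring ≤ O.toSubring), A.FG ∧ IsFractionRing A K ∧
            IsRegularLocalRing (Localization.AtPrime
              (Ideal.comap (Subring.inclusion h) (IsLocalRing.maximalIdeal O)))) →
      ∀ (k : Type) [Field k] [CharP k p] [PerfectField k] (X : Scheme.{0})
        (f : X ⟶ Spec (.of k)), IsSeparated f → LocallyOfFiniteType f → QuasiCompact f →
        IsReduced X → Scheme.HasResolution X) :
    Pialt := by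
  refine pialt_of_pialt_perfectField fun p hp k _ _ _ X f hs hl hq hi => ?_
  haveI : Fact p.Prime := ⟨hp⟩
  haveI := hs; haveI := hl; haveI := hq; haveI := hi
  refine pialtConclusion_of_hasResolution X (hP p hp ?_ k X f hs hl hq inferInstance)
  intro k' K _ _ _ _ _ hfg O hO
  exact isLocallyUniformizable_perfect hT (hB hF hQ) k' K hfg O hO

/-- **COMPOSITION: the crux BY NAME from the registered stubs.** -/
theorem Pialt_of : Pialt :=
  Pialt_of_stubs stub_inseparableLU stub_folLU stub_logCanQuotLU stub_foliationBridge
    stub_patchingPerfect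

end Summit.ResolutionOfSingularities.ResolutionOfSingularities.Cruxes.Pialt.FoliationSandwich

end
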